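import Summits.AtomisticToContinuum.Crystallization.Theorems.ExcessDecayLiouvillePhononStabilityCertModelF
import Summits.AtomisticToContinuum.Crystallization.Theorems.ExcessDecayLiouvillePhononStabilityCertPSD
import Summits.AtomisticToContinuum.Crystallization.Theorems.ExcessDecayLiouvillePhononStabilityCertGramQ
import Summits.AtomisticToContinuum.Crystallization.Theorems.ExcessDecayLiouvillePhononStabilityCertCharge

/-!
# Near-certificate layer V4: the node check of the vertex scheme and its soundness (lead c2)

Support file for crux `PhononStability` (stmt-AtomisticToContinuum-9333), line `contragredient-window-collapse`.

At a rational grid node `q` every ingredient of the model form `Fmodel` (layer V6-a) is an exact rational `3 × 3`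
matrix per class (`classMatQ`, `matValQ`); rounded DOWN to a dyadic scale in the quadratic-form order (`rdMat`) they
give the node target pairs, and the node defect (the curvature dominators of the node's sharing box, weighted by
`h_v²/2`, supplied by a `DefectProvider`: per class either the node's sharing box or a global table) rounded UP
(`ruMat`) gives the defect pairs (`nodePairs`).  The node check takes, per base sublattice, an
INTEGER Gram matrix over the difference star (as arrays; any matrices: produced by an unverified placement + completion
routine),
verifies positive semidefiniteness with `psdCheckZ` (layer V1) and verifies with the canonical-form zero test `isZeroT`
that the two Gram forms expand to exactly the node pairs.  Soundness (`node_sound`): the model form dominates the node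
defect at the node, for every finitely supported test field — the vertex input of the cell theorem (layer V6-b).
-/

noncomputable section

open scoped BigOperators
open Set Function
open Summit.AtomisticToContinuum.Crystallization.Theorems.PhononStabilityNegative

namespace Summit.AtomisticToContinuum.Crystallization.Theorems.PhononStabilityCWC.Cert

local notation "E3" => EuclideanSpace ℝ (Fin 3)

/-! ## Exact rational evaluation at a rational point -/

/-- the real assignment of a rational one -/
def castQ (q : ℕ → ℚ) : ℕ → ℝ := fun v => (q v : ℝ)

/-- rational monomial value -/
def monoValQ (q : ℕ → ℚ) (m : Mono) : ℚ := (m.map q).prod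

/-- rational polynomial value -/
def spEvalQ (q : ℕ → ℚ) (p : SPoly) : ℚ := (p.map fun e => monoValQ q e.1 * e.2).sum

/-- rational polynomial-matrix value -/
def matValQ (q : ℕ → ℚ) (L : List (Mono × Mat)) : Mat := fun i j => (L.map fun e => monoValQ q e.1 * e.2 i j).sum

/-- cast of the monomial value. [folklore] -/
theorem monoVal_castQ (q : ℕ → ℚ) (m : Mono) : monoVal (castQ q) m = (monoValQ q m : ℝ) := by
  induction m with
  | nil => simp [monoVal, monoValQ]
  | cons a m ih => rw [monoVal_cons', ih]; simp [monoValQ, castQ]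

/-- cast of the polynomial value. [folklore] -/
theorem spEval_castQ (q : ℕ → ℚ) (p : SPoly) : spEval p (castQ q) = (spEvalQ q p : ℝ) := by
  induction p with
  | nil => simp [spEvalQ]
  | cons e p ih => rw [spEval_cons, ih, monoVal_castQ]; simp [spEvalQ]

/-- cast of the polynomial-matrix value. [folklore] -/
theorem matVal_castQ (q : ℕ → ℚ) (L : List (Mono × Mat)) (i j : Fin 3) : matVal (castQ q) L i j = (matValQ q L i j : ℝ) := by
  induction L with
  | nil => simp [matVal, matValQ]
  | cons e L ih => rw [matVal_cons, ih, monoVal_castQ]; simp [matValQ]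

/-- rational `ω̃` -/
def omegaTQ (ρ : ℚ) : ℚ := 14 / ρ ^ 8 - 8 / ρ ^ 5
/-- rational `ψ̃` -/
def psiTQ (ρ : ℚ) : ℚ := -(1 / ρ ^ 7) + 1 / ρ ^ 4

/-- cast of `ω̃`. [folklore] -/
theorem omegaT_castQ (ρ : ℚ) : omegaT (ρ : ℝ) = (omegaTQ ρ : ℝ) := by
  unfold omegaT omegaTQ; push_cast; simp [div_eq_mul_inv]

/-- cast of `ψ̃`. [folklore] -/
theorem psiT_castQ (ρ : ℚ) : psiT (ρ : ℝ) = (psiTQ ρ : ℝ) := by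
  unfold psiT psiTQ; push_cast; simp [div_eq_mul_inv]

/-! ## Dyadic rounding in the quadratic-form order -/

/-- round down to denominator `2^p` -/
def floorP (p : ℕ) (x : ℚ) : ℚ := (⌊x * 2 ^ p⌋ : ℚ) / 2 ^ p

/-- `floorP x ≤ x < floorP x + 2^{-p}`. [folklore] -/
theorem floorP_le (p : ℕ) (x : ℚ) : floorP p x ≤ x ∧ x < floorP p x + 1 / 2 ^ p := by
  unfold floorP
  have h2 : (0 : ℚ) < 2 ^ p := by positivity
  constructor
  · rw [div_le_iff₀ h2]; exact Int.floor_le _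
  · have := Int.lt_floor_add_one (x * 2 ^ p)
    rw [← add_div, lt_div_iff₀ h2]; linarith

/-- round a matrix DOWN in the quadratic-form order: entrywise floor minus `3·2^{-p}` on the diagonal -/
def rdMat (p : ℕ) (M : Mat) : Mat := fun i j => floorP p (M i j) - if i = j then 3 / 2 ^ p else 0

/-- round a matrix UP in the quadratic-form order -/
def ruMat (p : ℕ) (M : Mat) : Mat := fun i j => -floorP p (-M i j) + if i = j then 3 / 2 ^ p else 0

/-- an entrywise-small perturbation is dominated by `3ε` times the identity. [folklore] -/
theorem bilR_small_le {E : Fin 3 → Fin 3 → ℝ} {ε : ℝ} (hE : ∀ i j, |E i j| ≤ ε) (u : Fin 3 → ℝ) :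
    |bilR E u u| ≤ 3 * ε * ∑ i, u i ^ 2 := by
  have hε : 0 ≤ ε := (abs_nonneg _).trans (hE 0 0)
  have hterm : ∀ i j, |E i j * u i * u j| ≤ ε * ((u i ^ 2 + u j ^ 2) / 2) := by
    intro i j
    rw [abs_mul, abs_mul]
    have h2 : |u i| * |u j| ≤ (u i ^ 2 + u j ^ 2) / 2 := by
      nlinarith [sq_nonneg (|u i| - |u j|), sq_abs (u i), sq_abs (u j)]
    calc |E i j| * |u i| * |u j| = |E i j| * (|u i| * |u j|) := by ring
      _ ≤ ε * ((u i ^ 2 + u j ^ 2) / 2) := mul_le_mul (hE i j) h2 (mul_nonneg (abs_nonneg _) (abs_nonneg _)) hε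
  unfold bilR
  calc |∑ i, ∑ j, E i j * u i * u j| ≤ ∑ i, |∑ j, E i j * u i * u j| := Finset.abs_sum_le_sum_abs _ _
    _ ≤ ∑ i, ∑ j, |E i j * u i * u j| := Finset.sum_le_sum fun i _ => Finset.abs_sum_le_sum_abs _ _
    _ ≤ ∑ i, ∑ j, ε * ((u i ^ 2 + u j ^ 2) / 2) := Finset.sum_le_sum fun i _ => Finset.sum_le_sum fun j _ => hterm i j
    _ = 3 * ε * ∑ i, u i ^ 2 := by simp only [Fin.sum_univ_three]; ring

/-- **rounding down is below.** [folklore] -/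
theorem rdMat_le (p : ℕ) (M : Mat) : MatLE (fun i j => (rdMat p M i j : ℝ)) (fun i j => (M i j : ℝ)) := by
  intro u
  -- `M − rd M = E + 3ε I` with `|E| ≤ ε`
  set ε : ℝ := 1 / 2 ^ p with hε
  have hE : ∀ i j, |((M i j - floorP p (M i j) : ℚ) : ℝ)| ≤ ε := by
    intro i j
    obtain ⟨h1, h2⟩ := floorP_le p (M i j)
    rw [abs_le]; constructor
    · have : (0 : ℝ) ≤ ((M i j - floorP p (M i j) : ℚ) : ℝ) := by exact_mod_cast (by linarith : (0 : ℚ) ≤ M i j - floorP p (M i j))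
      have hε0 : 0 ≤ ε := by rw [hε]; positivity
      linarith
    · have hq : M i j - floorP p (M i j) ≤ 1 / 2 ^ p := by linarith
      have : ((M i j - floorP p (M i j) : ℚ) : ℝ) ≤ ((1 / 2 ^ p : ℚ) : ℝ) := Rat.cast_le.mpr hq
      rw [hε]; push_cast at this ⊢; exact this
  have hsmall := bilR_small_le hE u
  have hsplit : bilR (fun i j => (M i j : ℝ)) u u - bilR (fun i j => (rdMat p M i j : ℝ)) u u
      = bilR (fun i j => ((M i j - floorP p (M i j) : ℚ) : ℝ)) u u + 3 * ε * ∑ i, u i ^ 2 := by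
    simp [bilR, rdMat, Fin.sum_univ_three, hε]; ring
  have := neg_abs_le (bilR (fun i j => ((M i j - floorP p (M i j) : ℚ) : ℝ)) u u)
  linarith

/-- **rounding up is above.** [folklore] -/
theorem le_ruMat (p : ℕ) (M : Mat) : MatLE (fun i j => (M i j : ℝ)) (fun i j => (ruMat p M i j : ℝ)) := by
  intro u
  have h := rdMat_le p (fun i j => -M i j) (fun i => u i)
  have e1 : bilR (fun i j => ((rdMat p fun i j => -M i j) i j : ℝ)) u u = -bilR (fun i j => (ruMat p M i j : ℝ)) u u := by
    simp only [bilR, rdMat, ruMat]; push_cast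
    rw [← Finset.sum_neg_distrib]; refine Finset.sum_congr rfl fun i _ => ?_
    rw [← Finset.sum_neg_distrib]; refine Finset.sum_congr rfl fun j _ => ?_
    ring
  have e2 : bilR (fun i j => ((-M i j : ℚ) : ℝ)) u u = -bilR (fun i j => (M i j : ℝ)) u u := by
    simp only [bilR]; push_cast
    rw [← Finset.sum_neg_distrib]; refine Finset.sum_congr rfl fun i _ => ?_
    rw [← Finset.sum_neg_distrib]; refine Finset.sum_congr rfl fun j _ => ?_
    ring
  rw [e1, e2] at h
  linarith

/-! ## The node pairs -/

/-- the exact class matrix at the node: `ω̃(ρ) Z(q) + ψ̃(ρ) Λ(q)` -/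
def classMatQ (e : ClassDat) (q : ℕ → ℚ) : Mat :=
  let ρ := e.ρbar + spEvalQ q e.P
  fun i j => omegaTQ ρ * matValQ q e.Z i j + psiTQ ρ * matValQ q e.Λ i j

/-- the class model term at a rational node is the pair form of `classMatQ`. [folklore] -/
theorem classModel_castQ {w : Label → E3} (hw : (support w).Finite) (e : ClassDat) (q : ℕ → ℚ) :
    classModel e.ρbar e.P e.Z e.Λ e.c (castQ q) w = pairEvalR e.c (fun i j => (classMatQ e q i j : ℝ)) w := by
  unfold classModel classMatQ
  have hZ : matVal (castQ q) e.Z = fun i j => (matValQ q e.Z i j : ℝ) := by funext i j; exact matVal_castQ q e.Z i j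
  have hΛ : matVal (castQ q) e.Λ = fun i j => (matValQ q e.Λ i j : ℝ) := by funext i j; exact matVal_castQ q e.Λ i j
  rw [spEval_castQ, hZ, hΛ, ← Rat.cast_add, omegaT_castQ, psiT_castQ]
  have hsplit : (fun i j => ((omegaTQ (e.ρbar + spEvalQ q e.P) * matValQ q e.Z i j
      + psiTQ (e.ρbar + spEvalQ q e.P) * matValQ q e.Λ i j : ℚ) : ℝ))
      = fun i j => (omegaTQ (e.ρbar + spEvalQ q e.P) : ℝ) * (matValQ q e.Z i j : ℝ)
        + (psiTQ (e.ρbar + spEvalQ q e.P) : ℝ) * (matValQ q e.Λ i j : ℝ) := by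
    funext i j; push_cast; ring
  rw [hsplit, pairEvalR_add hw, pairEvalR_smul, pairEvalR_smul]

/-- the node target pairs (rounded down): classes, affine part, minus the convex part (rounded up) -/
def targetPairs (CL : List ClassDat) (Aff Cq : List (BondClass × List (Mono × Mat))) (p : ℕ) (q : ℕ → ℚ) :
    List (BondClass × Mat) :=
  (CL.map fun e => (e.c, rdMat p (classMatQ e q))) ++ (Aff.map fun a => (a.1, rdMat p (matValQ q a.2)))
    ++ (Cq.map fun a => (a.1, mscale (-1) (ruMat p (matValQ q a.2))))

/-- **the target pairs are below the model form at the node.** [folklore] -/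
theorem targetPairs_le {w : Label → E3} (hw : (support w).Finite) (CL : List ClassDat)
    (Aff Cq : List (BondClass × List (Mono × Mat))) (p : ℕ) (q : ℕ → ℚ) :
    ((targetPairs CL Aff Cq p q).map fun pr => pairEval pr.1 pr.2 w).sum ≤ Fmodel CL Aff Cq (castQ q) w := by
  unfold targetPairs Fmodel
  rw [List.map_append, List.map_append, List.sum_append, List.sum_append, List.map_map, List.map_map, List.map_map]
  have h1 : ((CL.map ((fun pr => pairEval pr.1 pr.2 w) ∘ fun e => (e.c, rdMat p (classMatQ e q)))).sum)
      ≤ (CL.map fun e => classModel e.ρbar e.P e.Z e.Λ e.c (castQ q) w).sum := by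
    refine List.sum_le_sum fun e _ => ?_
    simp only [Function.comp_apply, pairEval_eq_pairEvalR, classModel_castQ hw]
    exact pairEvalR_mono hw e.c (rdMat_le p _)
  have h2 : ((Aff.map ((fun pr => pairEval pr.1 pr.2 w) ∘ fun a => (a.1, rdMat p (matValQ q a.2)))).sum)
      ≤ (Aff.map fun a => pairEvalR a.1 (matVal (castQ q) a.2) w).sum := by
    refine List.sum_le_sum fun a _ => ?_
    simp only [Function.comp_apply, pairEval_eq_pairEvalR]
    have hM : matVal (castQ q) a.2 = fun i j => (matValQ q a.2 i j : ℝ) := by funext i j; exact matVal_castQ q a.2 i j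
    rw [hM]
    exact pairEvalR_mono hw a.1 (rdMat_le p _)
  have h3 : ((Cq.map ((fun pr => pairEval pr.1 pr.2 w) ∘ fun a => (a.1, mscale (-1) (ruMat p (matValQ q a.2))))).sum)
      ≤ (Cq.map fun a => -pairEvalR a.1 (matVal (castQ q) a.2) w).sum := by
    refine List.sum_le_sum fun a _ => ?_
    simp only [Function.comp_apply, pairEval_eq_pairEvalR]
    have hM : matVal (castQ q) a.2 = fun i j => (matValQ q a.2 i j : ℝ) := by funext i j; exact matVal_castQ q a.2 i j
    have hneg : (fun i j => ((mscale (-1) (ruMat p (matValQ q a.2)) i j : ℚ) : ℝ))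
        = fun i j => (-1 : ℝ) * (ruMat p (matValQ q a.2) i j : ℝ) := by
      funext i j; simp [mscale]
    rw [hM, hneg, pairEvalR_smul]
    have := pairEvalR_mono hw a.1 (le_ruMat p (matValQ q a.2))
    linarith
  rw [list_sum_map_neg] at h3
  linarith

/-! ## The node defect -/

/-- the sharing box of a node: half-widths `H` around `q` in the variables `1 … 9` -/
def nodeBox (q H : ℕ → ℚ) : Box := fun v => if 1 ≤ v ∧ v ≤ 9 then ⟨q v - H v, q v + H v⟩ else ⟨0, 0⟩

/-- a DEFECT PROVIDER assigns to every class datum the curvature dominator matrices `W_{e,v}` used at a node: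
for the dominant (nearest-neighbour) classes the dominators of the node's sharing box, for all others a fixed
global table (computed once).  Only its relation to `curvW (curvD … box_e)` for boxes `box_e ⊇ nodeBox` matters. -/
structure DefectProvider where
  /-- the box used for class `e` at the node `(q, H)` -/
  boxOf : ClassDat → (ℕ → ℚ) → (ℕ → ℚ) → Box
  /-- the dominator matrix of `(e, v)` at the node -/
  W : ClassDat → ℕ → (ℕ → ℚ) → (ℕ → ℚ) → Mat
  /-- it DOMINATES the curvature dominator of that box (equality for computed providers, an inequality for shipped,
  once-verified tables) -/
  W_ge : ∀ e v q H, MatLE (fun i j => (curvW (curvD e.ρbar e.P e.Z e.Λ v e.U (boxOf e q H)) e.Uinv i j : ℝ))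
    (fun i j => (W e v q H i j : ℝ))

/-- the canonical provider: every class uses the node's sharing box -/
def nodeProvider : DefectProvider where
  boxOf := fun _ q H => nodeBox q H
  W := fun e v q H => curvW (curvD e.ρbar e.P e.Z e.Λ v e.U (nodeBox q H)) e.Uinv
  W_ge := fun _ _ _ _ _ => le_rfl

/-- the exact defect matrix of a class at a node: `Σ_v (h_v²/2) W_{e,v}` with cell half-widths `h` -/
def defMatQ (DP : DefectProvider) (e : ClassDat) (q H h : ℕ → ℚ) : Mat := fun i j =>
  ((List.range 9).map fun k => h (k + 1) ^ 2 / 2 * DP.W e (k + 1) q H i j).sum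

/-- the node defect form `Σ_v (h_v²/2) Σ_e P_e(W_{e,v})(w)` -/
def nodeDefect (DP : DefectProvider) (CL : List ClassDat) (q H h : ℕ → ℚ) (w : Label → E3) : ℝ :=
  ((List.range 9).map fun k => ((h (k + 1)) ^ 2 / 2 : ℚ) *
    (CL.map fun e => pairEvalR e.c (fun i j => (DP.W e (k + 1) q H i j : ℝ)) w).sum).sum

/-- the defect pairs (rounded up) -/
def defPairs (DP : DefectProvider) (CL : List ClassDat) (p : ℕ) (q H h : ℕ → ℚ) : List (BondClass × Mat) :=
  CL.map fun e => (e.c, ruMat p (defMatQ DP e q H h))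

/-- exchanging the class sum and the variable sum in the node defect. [folklore] -/
theorem nodeDefect_eq {w : Label → E3} (hw : (support w).Finite) (DP : DefectProvider) (CL : List ClassDat)
    (q H h : ℕ → ℚ) :
    nodeDefect DP CL q H h w = (CL.map fun e => pairEvalR e.c (fun i j => (defMatQ DP e q H h i j : ℝ)) w).sum := by
  unfold nodeDefect
  have hR : ∀ e : ClassDat, pairEvalR e.c (fun i j => (defMatQ DP e q H h i j : ℝ)) w
      = ((List.range 9).map fun k => ((h (k + 1)) ^ 2 / 2 : ℚ) *
          pairEvalR e.c (fun i j => (DP.W e (k + 1) q H i j : ℝ)) w).sum := by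
    intro e
    unfold defMatQ
    have key : ∀ (l : List ℕ), pairEvalR e.c (fun i j => (((l.map fun k => h (k + 1) ^ 2 / 2 *
        DP.W e (k + 1) q H i j).sum : ℚ) : ℝ)) w
        = (l.map fun k => ((h (k + 1)) ^ 2 / 2 : ℚ) * pairEvalR e.c (fun i j => (DP.W e (k + 1) q H i j : ℝ)) w).sum := by
      intro l
      induction l with
      | nil => simp [pairEvalR, bilR]
      | cons k l ih =>
          simp only [List.map_cons, List.sum_cons]
          rw [← ih, ← pairEvalR_smul, ← pairEvalR_add hw]
          congr 1; funext i j; push_cast; ring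
    exact key _
  simp only [hR]
  have swap : ∀ (l : List ℕ) (L : List ClassDat) (f : ℕ → ClassDat → ℝ),
      (l.map fun k => (L.map fun e => f k e).sum).sum = (L.map fun e => (l.map fun k => f k e).sum).sum := by
    intro l L f
    induction l with
    | nil => simp
    | cons k l ih =>
        simp only [List.map_cons, List.sum_cons, ih]
        clear ih
        induction L with
        | nil => simp
        | cons e L ih2 => simp only [List.map_cons, List.sum_cons]; linarith
  rw [← swap]
  refine congrArg List.sum (List.map_congr_left fun k _ => ?_)
  rw [← List.sum_map_mul_left]

/-- **the node defect is below its rounded pairs.** [folklore] -/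
theorem nodeDefect_le {w : Label → E3} (hw : (support w).Finite) (DP : DefectProvider) (CL : List ClassDat) (p : ℕ)
    (q H h : ℕ → ℚ) :
    nodeDefect DP CL q H h w ≤ ((defPairs DP CL p q H h).map fun pr => pairEval pr.1 pr.2 w).sum := by
  rw [nodeDefect_eq hw]
  unfold defPairs
  rw [List.map_map]
  refine List.sum_le_sum fun e _ => ?_
  simp only [Function.comp_apply, pairEval_eq_pairEvalR]
  exact pairEvalR_mono hw e.c (le_ruMat p _)

/-! ## The node check -/

/-- the node pairs: target minus defect -/
def nodePairs (DP : DefectProvider) (CL : List ClassDat) (Aff Cq : List (BondClass × List (Mono × Mat))) (p : ℕ)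
    (q H h : ℕ → ℚ) : List (BondClass × Mat) :=
  targetPairs CL Aff Cq p q ++ (defPairs DP CL p q H h).map fun pr => (pr.1, mscale (-1) pr.2)

/-- a dyadic rational matrix from an integer one -/
def qOfInt (p : ℕ) (A : ℕ → ℕ → ℤ) : ℕ → ℕ → ℚ := fun I J => (A I J : ℚ) / 2 ^ p

/-- **THE NODE CHECK** (per base star an integer Gram matrix): positive semidefiniteness and exact expansion. -/
def nodeCheckWith (G : Fin 2 → GramP) (A : Array (Array ℤ) × Array (Array ℤ)) (σ : ℤ × ℤ) (DP : DefectProvider)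
    (CL : List ClassDat) (Aff Cq : List (BondClass × List (Mono × Mat))) (p : ℕ) (q H h : ℕ → ℚ) : Bool :=
  psdCheckZ ((G 0).S * 3) (aget A.1) σ.1 && psdCheckZ ((G 1).S * 3) (aget A.2) σ.2
    && isZeroT ((G 0).qTable (qOfInt p (aget A.1)) ++ (G 1).qTable (qOfInt p (aget A.2))
      ++ smulT (-1) (pairTables (nodePairs DP CL Aff Cq p q H h)))

/-- integer PSD gives dyadic PSD. [folklore] -/
theorem matPSD_qOfInt {n : ℕ} {A : ℕ → ℕ → ℤ} {σ : ℤ} (p : ℕ) (h : psdCheckZ n A σ = true) : MatPSD n (qOfInt p A) := by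
  intro v
  have h0 := psd_of_psdCheckZ h v
  have h2 : (0 : ℝ) < 2 ^ p := by positivity
  have : ∑ I : Fin n, ∑ J : Fin n, (qOfInt p A I.val J.val : ℝ) * v I * v J
      = (∑ I : Fin n, ∑ J : Fin n, (A I.val J.val : ℝ) * v I * v J) / 2 ^ p := by
    rw [Finset.sum_div]; refine Finset.sum_congr rfl fun I _ => ?_
    rw [Finset.sum_div]; refine Finset.sum_congr rfl fun J _ => ?_
    simp only [qOfInt]; push_cast; ring
  rw [this]
  exact div_nonneg h0 h2.le

/-- **SOUNDNESS OF THE NODE CHECK:** at the node, the model form dominates the node defect. [folklore] -/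
theorem node_sound {G : Fin 2 → GramP} {A : Array (Array ℤ) × Array (Array ℤ)} {σ : ℤ × ℤ} {DP : DefectProvider}
    {CL : List ClassDat} {Aff Cq : List (BondClass × List (Mono × Mat))} {p : ℕ} {q H h : ℕ → ℚ}
    (hchk : nodeCheckWith G A σ DP CL Aff Cq p q H h = true) {w : Label → E3} (hw : (support w).Finite) :
    nodeDefect DP CL q H h w ≤ Fmodel CL Aff Cq (castQ q) w := by
  unfold nodeCheckWith at hchk
  simp only [Bool.and_eq_true] at hchk
  obtain ⟨⟨h0, h1⟩, hz⟩ := hchk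
  have hzero := tpEval_eq_zero_of_isZeroT hw hz
  rw [tpEval_append, tpEval_append, tpEval_smulT, tpEval_pairTables hw, ← (G 0).qEval_eq_table hw,
    ← (G 1).qEval_eq_table hw] at hzero
  have hq0 := (G 0).qEval_nonneg (matPSD_qOfInt p h0) w
  have hq1 := (G 1).qEval_nonneg (matPSD_qOfInt p h1) w
  have hpairs : 0 ≤ ((nodePairs DP CL Aff Cq p q H h).map fun pr => pairEval pr.1 pr.2 w).sum := by
    push_cast at hzero; linarith
  unfold nodePairs at hpairs
  rw [List.map_append, List.sum_append, List.map_map] at hpairs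
  have hdef : ((defPairs DP CL p q H h).map ((fun pr => pairEval pr.1 pr.2 w) ∘ fun pr => (pr.1, mscale (-1) pr.2))).sum
      = -((defPairs DP CL p q H h).map fun pr => pairEval pr.1 pr.2 w).sum := by
    rw [← list_sum_map_neg]
    refine congrArg List.sum (List.map_congr_left fun pr _ => ?_)
    simp only [Function.comp_apply, pairEval_eq_pairEvalR]
    have : (fun i j => ((mscale (-1) pr.2 i j : ℚ) : ℝ)) = fun i j => (-1 : ℝ) * (pr.2 i j : ℝ) := by
      funext i j; simp [mscale]
    rw [this, pairEvalR_smul]; ring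
  rw [hdef] at hpairs
  have ht := targetPairs_le hw CL Aff Cq p q
  have hd := nodeDefect_le hw DP CL p q H h
  linarith

/-- Anchor of this support file (registered stub of the line skeleton, lead c2): rounding down the zero matrix. -/
theorem stub_certNode : rdMat 0 (fun _ _ => 0) 0 1 = 0 := by
  simp [rdMat, floorP]

end Summit.AtomisticToContinuum.Crystallization.Theorems.PhononStabilityCWC.Cert

end
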